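import Mathlib
import HarnessLib
import Summits.HubbardSuperconductivity.Statement
import Literature.MathematicalPhysics.QuantumLattice.DWaveSource
import Literature.Barriers.HubbardSuperconductivity.PureModelStripeCompetition
import Literature.Probability.LatticeModels.LatticeGraph

/-!
# Route `NodalWardXY` — the Assembly (item `stmt-HubbardSuperconductivity-1271`), structural form

The assembly item of route `HubbardSuperconductivity/NodalWardXY` (rev 1) is the curried statement
`VisonPairCost → PerturbedXYOrder → SsbToTorusLRO → NodalReduction → HubbardSuperconductivity`,
literally the type of the route file's deciding theorem `NodalWardXY.closes`. It is pure logic over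
the summit Statement: `NodalReduction` applied to the two engines (`VisonPairCost`,
`PerturbedXYOrder`) gives a doping `δ ∈ (0, 1/2)`, a ceiling `U₀ > 0` and, for every `U ∈ (0, U₀)`,
a density-matched chemical potential `μ` with positive Koma–Tasaki order parameter
(`HasDWaveOrder U μ`); the transfer `SsbToTorusLRO` gives its own window `U₁ > 0`; at
`U := min U₀ U₁ / 2` both apply and yield
`Literature.Barriers.HubbardSuperconductivity.HasDWavePairFieldLROAt U δ`, which is by `δ`-unfolding
the body of `Literature.Hubbard.DWaveSuperconductivityHubbard`, the definiens of the summit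
statement `HubbardSuperconductivity`. No analysis, no new definitions, no odd-`L` padding.

DESIGN (materialisation rule learned on the sibling routes `BalabanIR` rev 3–5 and `ThermalWedge`
rev 1–2 of this summit): when an item closes, the gate re-renders the route file
`Theses/NodalWardXY.lean` with `import <closing module>` and
`theorem Assembly_holds : Assembly := _root_.<closing theorem>`; a closing module that itself
imports the Theses module would close an import cycle (route unmaterialisable, `closes`
unauditable). Therefore this module does NOT import
`Summits.HubbardSuperconductivity.HubbardSuperconductivity.Theses.NodalWardXY`; the TYPE of the
theorem below is spelled out STRUCTURALLY — the verbatim bodies of the route decls `VisonPairCost`,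
`PerturbedXYOrder`, `SsbToTorusLRO` and `NodalReduction` (Theses/NodalWardXY.lean rev 1; the two
engine bodies occur twice because `NodalReduction` is stated conditionally on them) followed by the
summit constant `_root_.HubbardSuperconductivity` — over exactly the imports of the route file
(`Summits.HubbardSuperconductivity.Statement`, `Literature.MathematicalPhysics.QuantumLattice.DWaveSource`,
`Literature.Barriers.HubbardSuperconductivity.PureModelStripeCompetition`,
`Literature.Probability.LatticeModels.LatticeGraph`), so that it is definitionally equal to
`Summit.HubbardSuperconductivity.HubbardSuperconductivity.Theses.NodalWardXY.Assembly` by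
`δ`-unfolding of the five defs alone (checked against the rev-1 Theses file with
`example : NodalWardXY.Assembly := nodalWardXY_assembly_proof` in a scratch file importing both,
rc 0), and the route file can import this module without a cycle — the same device as
`Theorems/ThermalWedgeAssemblyStructural.lean` and `Theorems/BalabanIRAssemblyFrame.lean`.

The proof is the body of `NodalWardXY.closes` (planner glue, rev 1), term for term.
-/

namespace Summit.HubbardSuperconductivity.HubbardSuperconductivity.Theorems

open scoped BigOperators Topology Manifold Classical MeasureTheory ProbabilityTheory Matrix InnerProductSpace ComplexConjugate ContinuousMap
open Filter Set Function TopologicalSpace MeasureTheory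
open Literature.Hubbard

/-- **Assembly of route `NodalWardXY`** (item `stmt-HubbardSuperconductivity-1271`), stated
structurally: (vison pair cost `VisonPairCost`) → (perturbed-XY engine `PerturbedXYOrder`) →
(SSB ⇒ torus LRO transfer `SsbToTorusLRO`, = stmt-HubbardSuperconductivity-2009) →
(the conditional mechanism `NodalReduction`) → `HubbardSuperconductivity`, every hypothesis written
out verbatim so that this type `δ`-unfolds to
`Summit.HubbardSuperconductivity.HubbardSuperconductivity.Theses.NodalWardXY.Assembly`.
Pure logic: `NodalReduction` on the two engines gives `δ, U₀` and density-matched `μ` with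
`HasDWaveOrder U μ` for `U < U₀`; `SsbToTorusLRO` gives `U₁`; at `U := min U₀ U₁ / 2` the transfer
yields `HasDWavePairFieldLROAt U δ`, definitionally the body of the summit. [folklore] -/
theorem nodalWardXY_assembly_proof :
    (∀ μ : ℝ, μ ∈ Set.Ioo (-4 : ℝ) 4 → μ ≠ 0 → ∀ Δ₀ : ℝ, 0 < Δ₀ → ∃ C : ℝ, ∀ (L : ℕ) [NeZero L], 4 ≤ L → ∀ R : ℕ, 2 * R ≤ L → let c : Literature.Probability.LatticeModels.TorusSite 2 L → Fin 2 → Matrix (Finset (Literature.MathematicalPhysics.QuantumLattice.Orb (Literature.MathematicalPhysics.QuantumLattice.FermionTorus 2 L))) (Finset (Literature.MathematicalPhysics.QuantumLattice.Orb (Literature.MathematicalPhysics.QuantumLattice.FermionTorus 2 L))) ℂ := fun y σ => Literature.MathematicalPhysics.QuantumLattice.annihilation (Literature.MathematicalPhysics.QuantumLattice.orb (Literature.MathematicalPhysics.QuantumLattice.FermionTorus.ofTorusSite y) σ); let H : ℕ → Matrix (Finset (Literature.MathematicalPhysics.QuantumLattice.Orb (Literature.MathematicalPhysics.QuantumLattice.FermionTorus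 2 L))) (Finset (Literature.MathematicalPhysics.QuantumLattice.Orb (Literature.MathematicalPhysics.QuantumLattice.FermionTorus 2 L))) ℂ := fun R' => (∑ x : Literature.Probability.LatticeModels.TorusSite 2 L, ∑ i : Fin 2, (if i = 1 ∧ x 1 = 0 ∧ (x 0).val < R' then (-1 : ℂ) else 1) • ((∑ σ : Fin 2, -((c x σ)ᴴ * c (x + Pi.single i 1) σ + (c (x + Pi.single i 1) σ)ᴴ * c x σ)) + ((Δ₀ * (if i = 0 then (1 : ℝ) else -1) : ℝ) : ℂ) • ((c x 0 * c (x + Pi.single i 1) 1 - c x 1 * c (x + Pi.single i 1) 0) + (c x 0 * c (x + Pi.single i 1) 1 - c x 1 * c (x + Pi.single i 1) 0)ᴴ))) - (μ : ℂ) • Literature.MathematicalPhysics.QuantumLattice.totalNumber; |(H R).groundEnergy - (H 0).groundEnergy| ≤ C) →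
      (∃ J₀ ε a : ℝ, 0 < ε ∧ 0 < a ∧ ∀ J : ℝ, J₀ ≤ J → ∀ (L : ℕ) [NeZero L], 2 ≤ L → ∀ K : (Literature.Probability.LatticeModels.TorusSite 3 L × Fin 3) → (Literature.Probability.LatticeModels.TorusSite 3 L × Fin 3) → ℂ, (∀ b b', ‖K b b'‖ ≤ ε / (1 + ((Literature.Probability.LatticeModels.torusGraph 3 L).dist b.1 b'.1 : ℝ)) ^ 4) → let cube : Set (Literature.Probability.LatticeModels.TorusSite 3 L → ℝ) := Set.pi Set.univ (fun _ => Set.Icc (0:ℝ) (2 * Real.pi)); let cur : (Literature.Probability.LatticeModels.TorusSite 3 L × Fin 3) → (Literature.Probability.LatticeModels.TorusSite 3 L → ℝ) → ℝ := fun b θ => Real.sin (θ (b.1 + Pi.single b.2 1) - θ b.1); let wJ : (Literature.Probability.LatticeModels.TorusSite 3 L → ℝ) → ℂ := fun θ => ((Real.exp (J * ∑ b : Literature.Probability.LatticeModels.TorusSite 3 L × Fin 3, Real.cos (θ (b.1 + Pi.single b.2 1) - θ b.1)) : ℝ) : ℂ); let W : (Literature.Probability.LatticeModels.TorusSite 3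 L → ℝ) → ℂ := fun θ => ∑ b, ∑ b', K b b' * (cur b θ : ℂ) * (cur b' θ : ℂ); let Z : ℂ := MeasureTheory.integral (MeasureTheory.volume.restrict cube) (fun θ => wJ θ * Complex.exp (W θ)); Z ≠ 0 ∧ a ≤ ((∑ x : Literature.Probability.LatticeModels.TorusSite 3 L, ∑ y : Literature.Probability.LatticeModels.TorusSite 3 L, MeasureTheory.integral (MeasureTheory.volume.restrict cube) (fun θ => (Real.cos (θ x - θ y) : ℂ) * (wJ θ * Complex.exp (W θ)))) / Z / ((L : ℂ) ^ 6)).re) →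
      (∃ U₀ : ℝ, 0 < U₀ ∧ ∀ U ∈ Set.Ioo (0:ℝ) U₀, ∀ δ ∈ Set.Ioo (0:ℝ) (1 / 2), ∀ μ : ℝ, Filter.Tendsto (fun L : ℕ => ((Literature.MathematicalPhysics.QuantumLattice.hubbardTorusWith 2 (L + 1) 1 U μ).groundStateFunctional Literature.MathematicalPhysics.QuantumLattice.totalNumber).re / ((L + 1 : ℕ) : ℝ) ^ 2) Filter.atTop (nhds (1 - δ)) → Literature.MathematicalPhysics.QuantumLattice.HasDWaveOrder U μ → Literature.Barriers.HubbardSuperconductivity.HasDWavePairFieldLROAt U δ) →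
      ((∀ μ : ℝ, μ ∈ Set.Ioo (-4 : ℝ) 4 → μ ≠ 0 → ∀ Δ₀ : ℝ, 0 < Δ₀ → ∃ C : ℝ, ∀ (L : ℕ) [NeZero L], 4 ≤ L → ∀ R : ℕ, 2 * R ≤ L → let c : Literature.Probability.LatticeModels.TorusSite 2 L → Fin 2 → Matrix (Finset (Literature.MathematicalPhysics.QuantumLattice.Orb (Literature.MathematicalPhysics.QuantumLattice.FermionTorus 2 L))) (Finset (Literature.MathematicalPhysics.QuantumLattice.Orb (Literature.MathematicalPhysics.QuantumLattice.FermionTorus 2 L))) ℂ := fun y σ => Literature.MathematicalPhysics.QuantumLattice.annihilation (Literature.MathematicalPhysics.QuantumLattice.orb (Literature.MathematicalPhysics.QuantumLattice.FermionTorus.ofTorusSite y) σ); let H : ℕ → Matrix (Finset (Literature.MathematicalPhysics.QuantumLattice.Orb (Literature.MathematicalPhysics.QuantumLattice.FermionTorus 2 L))) (Finset (Literature.MathematicalPhysics.QuantumLattice.Orb (Literature.MathematicalPhysics.QuantumLattice.FermionTorus 2 L))) ℂ := fun R' => (∑ x : Literature.Probability.LatticeModels.TorusSite 2 L, ∑ i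 : Fin 2, (if i = 1 ∧ x 1 = 0 ∧ (x 0).val < R' then (-1 : ℂ) else 1) • ((∑ σ : Fin 2, -((c x σ)ᴴ * c (x + Pi.single i 1) σ + (c (x + Pi.single i 1) σ)ᴴ * c x σ)) + ((Δ₀ * (if i = 0 then (1 : ℝ) else -1) : ℝ) : ℂ) • ((c x 0 * c (x + Pi.single i 1) 1 - c x 1 * c (x + Pi.single i 1) 0) + (c x 0 * c (x + Pi.single i 1) 1 - c x 1 * c (x + Pi.single i 1) 0)ᴴ))) - (μ : ℂ) • Literature.MathematicalPhysics.QuantumLattice.totalNumber; |(H R).groundEnergy - (H 0).groundEnergy| ≤ C) → (∃ J₀ ε a : ℝ, 0 < ε ∧ 0 < a ∧ ∀ J : ℝ, J₀ ≤ J → ∀ (L : ℕ) [NeZero L], 2 ≤ L → ∀ K : (Literature.Probability.LatticeModels.TorusSite 3 L × Fin 3) → (Literature.Probability.LatticeModels.TorusSite 3 L × Fin 3) → ℂ, (∀ b b', ‖K b b'‖ ≤ ε / (1 + ((Literature.Probability.LatticeModels.torusGraph 3 L).dist b.1 b'.1 : ℝ)) ^ 4) → let cube : Set (Literature.Probability.LatticeModels.TorusSite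 3 L → ℝ) := Set.pi Set.univ (fun _ => Set.Icc (0:ℝ) (2 * Real.pi)); let cur : (Literature.Probability.LatticeModels.TorusSite 3 L × Fin 3) → (Literature.Probability.LatticeModels.TorusSite 3 L → ℝ) → ℝ := fun b θ => Real.sin (θ (b.1 + Pi.single b.2 1) - θ b.1); let wJ : (Literature.Probability.LatticeModels.TorusSite 3 L → ℝ) → ℂ := fun θ => ((Real.exp (J * ∑ b : Literature.Probability.LatticeModels.TorusSite 3 L × Fin 3, Real.cos (θ (b.1 + Pi.single b.2 1) - θ b.1)) : ℝ) : ℂ); let W : (Literature.Probability.LatticeModels.TorusSite 3 L → ℝ) → ℂ := fun θ => ∑ b, ∑ b', K b b' * (cur b θ : ℂ) * (cur b' θ : ℂ); let Z : ℂ := MeasureTheory.integral (MeasureTheory.volume.restrict cube) (fun θ => wJ θ * Complex.exp (W θ)); Z ≠ 0 ∧ a ≤ ((∑ x : Literature.Probability.LatticeModels.TorusSite 3 L, ∑ y : Literature.Probability.LatticeModels.TorusSite 3 L, MeasureTheory.integral (MeasureTheory.volume.restrict cube) (fun θ => (Real.cos (θ x - θ y) : ℂ) * (wJ θ * Complex.exp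 (W θ)))) / Z / ((L : ℂ) ^ 6)).re) → ∃ δ ∈ Set.Ioo (0:ℝ) (1/2), ∃ U₀ : ℝ, 0 < U₀ ∧ ∀ U ∈ Set.Ioo (0:ℝ) U₀, ∃ μ : ℝ, Filter.Tendsto (fun L : ℕ => ((Literature.MathematicalPhysics.QuantumLattice.hubbardTorusWith 2 (L + 1) 1 U μ).groundStateFunctional Literature.MathematicalPhysics.QuantumLattice.totalNumber).re / ((L + 1 : ℕ) : ℝ) ^ 2) Filter.atTop (nhds (1 - δ)) ∧ Literature.MathematicalPhysics.QuantumLattice.HasDWaveOrder U μ) →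
      _root_.HubbardSuperconductivity := by
  intro h_VisonPairCost h_PerturbedXYOrder h_SsbToTorusLRO h_NodalReduction
  obtain ⟨δ, hδ, U₀, hU₀, hwin⟩ := h_NodalReduction h_VisonPairCost h_PerturbedXYOrder
  obtain ⟨U₁, hU₁, htr⟩ := h_SsbToTorusLRO
  have hm : 0 < min U₀ U₁ := lt_min hU₀ hU₁
  obtain ⟨μ, hdens, hord⟩ := hwin (min U₀ U₁ / 2)
    ⟨half_pos hm, lt_of_lt_of_le (half_lt_self hm) (min_le_left _ _)⟩
  show Literature.Hubbard.DWaveSuperconductivityHubbard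
  exact ⟨min U₀ U₁ / 2, half_pos hm, δ, hδ,
    htr (min U₀ U₁ / 2) ⟨half_pos hm, lt_of_lt_of_le (half_lt_self hm) (min_le_right _ _)⟩
      δ hδ μ hdens hord⟩

end Summit.HubbardSuperconductivity.HubbardSuperconductivity.Theorems
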